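import Literature.IUT.LogVolume.Corollary22PartII
import Literature.IUT.LogVolume.Corollary22GaloisImage
import Literature.IUT.LogVolume.Corollary23Chain
import Literature.IUT.LogVolume.Corollary23JInv
import HarnessLib

/-!
# [IUTchIV] §2 endpoint: Cor. 2.2 ⇒ Cor. 2.3 ⇒ abc, from the Theorem-1.10 interface `Thm110Legendre`

Mochizuki, *Inter-universal Teichmüller theory IV*, RIMS manuscript (Apr. 2020; = PRIMS **57** (2021)),
Cor. 2.2 (pp. 41–48), Cor. 2.3 (pp. 54–55); Mochizuki, *Arithmetic elliptic curves in general position*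
[GenEll] Thm. 2.1. PROOF-ONLY file (no definitions); it only COMPOSES landed theorems. TAKES NO SIDE on
the disputed step: the two hypotheses of `abc_of_thm110Legendre` are exactly
* `Cor22.Thm110Legendre` — what the proof of Cor. 2.2 (ii) takes from [IUTchIV] Theorem 1.10 (first
  display, p. 46 l. 1, incl. the existence of the initial Θ-data (P7)); Theorem 1.10 rests on [IUTchIII]
  Cor. 3.12 — DISPUTED CHAIN, hypothesis;
* `GenEll_thm21_primes` — [GenEll] Thm. 2.1 (ii) ⇒ (i) for `Σ` a finite set of primes (noncritical Belyi
  maps) — CLASSICAL named fact (faithful transcription, audit A-Sd2-F1).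
Everything else on the route [IUTchIV] Cor. 2.2 ⇒ Cor. 2.3 ⇒ [GenEll] Thm. 2.1 ⇒ abc is PROVED in the
tree: Cor. 2.2 (i) (`partI_holds`), (ii) (`partII_of_thm110Legendre`, with its classical Galois-image input
(P4) ⇒ (P6) DISCHARGED: `fullGaloisImage_holds`), (iii) (`Corollary22PartIII`), the Cor. 2.3 bookkeeping
(`bdLe_of_corollary22`, `abcCompactlyBounded_two_of_corollary22`), the "WLOG (∗^{j-inv})" sentence of
p. 55 (`jInvVacuous_holds`), Prop. 1.6 / 2.1 (prime number theorem), [GenEll] §3 (Lem. 3.1, 3.5, 3.7,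
Prop. 3.4, the Tate transvection). Nothing here asserts that abc is proved; `abc_of_thm110Legendre` says
abc follows from these two named inputs.
-/

noncomputable section

namespace Literature.IUT.LogVolume

namespace Cor22

open Literature.NumberTheory.DiophantineGeometry.GenEll Literature.NumberTheory.DiophantineGeometry

/-- **[GenEll] Thm. 2.1 (ii) for `Σ = {2}` from the Theorem-1.10 interface** (the proof of [IUTchIV] Cor.
2.3, p. 55, up to its final appeal to [GenEll] Thm. 2.1): `Thm110Legendre → ABCCompactlyBounded {2}`,
via `exists_corollary22_of_thm110Legendre` (with the Galois-image input `fullGaloisImage_holds`),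
`abcCompactlyBounded_two_of_corollary22` and `jInvVacuous_holds`. [claim: Mochizuki2012, status: disputed] -/
theorem abcCompactlyBounded_two_of_thm110Legendre (hH : Thm110Legendre) :
    ABCCompactlyBounded ({2} : Finset ℕ) := by
  obtain ⟨Hunif, h22⟩ := exists_corollary22_of_thm110Legendre hH fullGaloisImage_holds
  exact abcCompactlyBounded_two_of_corollary22 h22 jInvVacuous_holds

/-- **[IUTchIV] Corollary 2.3 for `(ℙ¹_ℚ, {0,1,∞})`, every degree `d`, from the Theorem-1.10 interface**:
`Thm110Legendre → GenEll_thm21_primes → ∀ d ≥ 1, VojtaP1Deg d` ([GenEll] Thm. 2.1 (i) on `U_X(ℚ̄)^{≤d}`: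
`ht ≲ (1+ε)(log-diff + log-cond)`). [claim: Mochizuki2012, status: disputed] -/
theorem vojtaP1Deg_of_thm110Legendre (hH : Thm110Legendre) (hfact : GenEll_thm21_primes) {d : ℕ}
    (hd : 0 < d) : VojtaP1Deg d :=
  vojtaP1Deg_of_abcCompactlyBounded_two_primes hfact (abcCompactlyBounded_two_of_thm110Legendre hH) hd

/-- **The campaign-S chain closed modulo its two named inputs**: the abc sentence for coprime triples,
`∀ ε > 0 ∃ C > 0 ∀ (a,b,c) abc-triple, c < C·rad(abc)^{1+ε}`, as a kernel-checked implication from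
`Thm110Legendre` (disputed chain: [IUTchIII] Cor. 3.12 ⇒ [IUTchIV] Thm. 1.10 ⇒ this interface) and
`GenEll_thm21_primes` ([GenEll] Thm. 2.1, classical named fact). Nothing is asserted unconditionally; no
side is taken on Cor. 3.12. [claim: Mochizuki2012, status: disputed] -/
theorem abc_of_thm110Legendre (hH : Thm110Legendre) (hfact : GenEll_thm21_primes) :
    ∀ ε : ℝ, 0 < ε → ∃ C : ℝ, 0 < C ∧
      ∀ a b c : ℕ, IsABCTriple a b c → (c : ℝ) < C * ((rad a b c : ℕ) : ℝ) ^ (1 + ε) :=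
  abc_of_abcCompactlyBounded_two_primes hfact (abcCompactlyBounded_two_of_thm110Legendre hH)

end Cor22

end Literature.IUT.LogVolume

end
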